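import Mathlib
import HarnessLib
import Literature.Analysis.FluidPDE.Tao2016AveragedNS.TaylorChainCertificate
import Summits.NavierStokesRegularity.NavierStokesRegularity.Theorems.TaylorModelRungThreeReadoutG4Transport

/-!
# Line `taylor-model` on crux K1b-DR (stmt-NavierStokesRegularity-23954) — stub G4 (`LandingC1`),
# helper 7: the rP-unit frame transport — induction over the nodes and the final bound

Sequel to `…ReadoutG4Transport` (one-step transport `segDeriv_step`). Here:

* `frame_invariant` — `|Ci u (D σ (Tn u))| ≤ λ_u · rP u` with `λ_u = NCi 0 · dm · ∏_{u'<u} (1 + κB u')`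
  (parallelepiped transport clause, `NCi`/`κB` clauses, scaling; G-PROOFPLAN §3 "the invariant");
* `wn_segDeriv_node` — hence `wn (D σ (Tn u)) ≤ λ_u · (ρO u − EO u)`;
* `transport_bound` — at any time `t` of the last sub-step,
  `wn (D σ t) ≤ L1 (S−1) · λ_{S−1} · (ρO (S−1) − EO (S−1))` (last leg by the (F4) two-point Lipschitz
  estimate `G3.inBall_sub_of_F4` at centre `x (S−1)` and the v3 exit clause `1/(1−bb(mC+ρO)h)² ≤ L1`).

MODEL-lattice bookkeeping only (rung TL-M3); nothing here is a statement about the Navier–Stokes equations.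
-/

noncomputable section

-- the sub-problem namespace repeats the summit name by design (D-0017)
set_option linter.dupNamespace false

namespace Summit.NavierStokesRegularity.NavierStokesRegularity.Theorems.TaylorModelReadout.G4

open scoped BigOperators Topology
open Set Filter Literature.Analysis.FluidPDE.TaoCascade Literature.Analysis.FluidPDE.TaoCascade.TaylorChain

variable {cd : CertData} {φ : Flow} {j : ℕ}

section Deriv

variable {q : Fin 4 → ℤ → ℝ} {D : ℝ → ℝ → (Fin (nW cd) → ℝ)} {σ : ℝ}

/-- **The frame invariant** (G-PROOFPLAN §3): in rP-units of node `u`, the derivative witness is bounded by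
`λ_u = NCi 0 · dm · ∏_{u' < u} (1 + κB u')`. [folklore] -/
theorem frame_invariant (hj : j ≤ cd.N₀) (hV : cd.Valid) (hF : IsFlowPackage cd φ) (hC : ChainEnclosure cd φ)
    (hq : InPoly cd j q)
    (hD : ∀ σ ∈ Icc (0:ℝ) 1, ∀ t ∈ Icc 0 (cd.Tn j (cd.S j)),
      HasDerivWithinAt (fun σ' => toVec cd (stAt φ j (seg cd j q σ') t)) (D σ t) (Icc 0 1) σ)
    (hσ : σ ∈ Icc (0:ℝ) 1) :
    ∀ u, u ≤ cd.S j - 1 → ∀ i k, -cd.Kb ≤ k → k ≤ cd.Ka →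
      |cd.Ci j u (ofVec cd (D σ (cd.Tn j u))) i k| ≤
        (cd.NCi j 0 * cd.dm j * ∏ u' ∈ Finset.range u, (1 + cd.κB j u')) * cd.rP j u i k := by
  have hω := G3.omega_pos hV hj
  have hS1 := S_sub_one_lt hV hj
  intro u
  induction u with
  | zero =>
    intro _ i k hk1 hk2
    rw [Finset.range_zero, Finset.prod_empty, mul_one, G3.Tn_zero hV hj]
    have hNCi := G3.NCi_clause hV hj (Nat.zero_le _)
    have h := scale_ball_apply (G3.isLinearMap_Ci hV hj (Nat.zero_le _)) (C := fun i k => cd.NCi j 0 * cd.rP j 0 i k)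
      hNCi.2 (wsupp_ofVec cd _) (dm_nonneg hV hj) (inBall_segDeriv_zero hj hV hC hq hD hσ) i ⟨hk1, hk2⟩
    calc |cd.Ci j 0 (ofVec cd (D σ 0)) i k| ≤ cd.NCi j 0 * cd.rP j 0 i k * cd.dm j := h
      _ = cd.NCi j 0 * cd.dm j * cd.rP j 0 i k := by ring
  | succ u ih =>
    intro hu1 i k hk1 hk2
    have hu : u < cd.S j := by omega
    have hu' : u ≤ cd.S j - 1 := by omega
    have hus : u + 1 ≤ cd.S j := by omega
    set lam : ℝ := cd.NCi j 0 * cd.dm j * ∏ u' ∈ Finset.range u, (1 + cd.κB j u') with hlamdef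
    have ih' : ∀ i k, -cd.Kb ≤ k → k ≤ cd.Ka → |cd.Ci j u (ofVec cd (D σ (cd.Tn j u))) i k| ≤ lam * cd.rP j u i k :=
      ih hu'
    -- nonnegativity of λ_u (window contains the shell 1)
    have hlam : 0 ≤ lam := by
      have h1 := ih' cd.i₀ 1 (one_mem_window hV).1 (one_mem_window hV).2
      have hr := G3.rP_nonneg hV hj hu.le cd.i₀ 1
      rcases hr.eq_or_lt with h0 | hpos
      · -- degenerate radius: use the product formula directly
        have hNCi0 := (G3.NCi_clause hV hj (Nat.zero_le _)).1
        refine mul_nonneg (mul_nonneg hNCi0 (dm_nonneg hV hj)) (Finset.prod_nonneg fun u' hu' => ?_)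
        have hu'S : u' < cd.S j := lt_trans (Finset.mem_range.1 hu') hu
        have hκB := κB_clause hV hj hu'S
        have h2 : 0 ≤ cd.NCi j (u' + 1) * (cd.RemV (cd.bb j) (cd.mC j u') (cd.h j u') +
            (1 / (1 - cd.bb j * (cd.mC j u' + cd.ρO j u') * cd.h j u') ^ 2 -
              1 / (1 - cd.bb j * cd.mC j u' * cd.h j u') ^ 2)) * (cd.ρO j u' - cd.EO j u') :=
          mul_nonneg (mul_nonneg (G3.NCi_clause hV hj (by omega)).1 (stepDefect_nonneg hj hV hu'S))
            (sub_nonneg.2 (EO_le_ρO hV hj hu'S.le))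
        linarith
      · exact nonneg_of_mul_nonneg_left ((abs_nonneg _).trans h1) hpos
    -- the frame coordinates of the current witness
    set Du := ofVec cd (D σ (cd.Tn j u)) with hDudef
    set ξ := cd.Ci j u Du with hξdef
    have hfr := G3.frame_wsupp hV hj hu.le
    have hξw : cd.Wsupp ξ := (hfr Du).2.1
    have hDu_w : cd.Wsupp Du := wsupp_ofVec cd _
    have hCmξ : cd.Cm j u ξ = Du := ((hfr Du).2.2 hDu_w).2
    -- (i) polynomial transport of the parallelepiped
    have hlinVC : IsLinearMap ℝ (fun ξ' => cd.Ci j (u + 1) (cd.Vap j u (cd.h j u) (cd.Cm j u ξ'))) := by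
      have h1 := G3.isLinearMap_Ci hV hj hus
      have h2 := G3.isLinearMap_Vap hV hj hu.le (cd.h j u)
      have h3 := G3.isLinearMap_Cm hV hj hu.le
      exact ⟨fun a b => by simp only [h3.map_add, h2.map_add, h1.map_add],
        fun r a => by simp only [h3.map_smul, h2.map_smul, h1.map_smul]⟩
    have hi : |cd.Ci j (u + 1) (cd.Vap j u (cd.h j u) (cd.Cm j u ξ)) i k| ≤ cd.rP j (u + 1) i k * lam :=
      scale_par_apply hlinVC (C := cd.rP j (u + 1)) (par_transport hV hj hu) hξw hlam
        (fun i k hk1 hk2 => ih' i k hk1 hk2) i ⟨hk1, hk2⟩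
    -- (ii) the ω-size of the current witness
    have hDu_ball : cd.InBall j Du (lam * (cd.ρO j u - cd.EO j u)) := by
      intro i' k' hk1' hk2'
      have h := scale_par_apply (G3.isLinearMap_Cm hV hj hu.le) (C := fun i k => (cd.ρO j u - cd.EO j u) * cd.ω j k)
        (fun ξ' hξ' i k hk1 hk2 => (G3.para_inBall hV hj hu.le ξ' hξ').2 i k hk1 hk2) hξw hlam
        (fun i k hk1 hk2 => ih' i k hk1 hk2) i' ⟨hk1', hk2'⟩
      rw [hCmξ] at h
      calc |Du i' k'| ≤ (cd.ρO j u - cd.EO j u) * cd.ω j k' * lam := h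
        _ = lam * (cd.ρO j u - cd.EO j u) * cd.ω j k' := by ring
    have hρE : 0 ≤ cd.ρO j u - cd.EO j u := sub_nonneg.2 (EO_le_ρO hV hj hu.le)
    have hwnDu : wn cd j (D σ (cd.Tn j u)) ≤ lam * (cd.ρO j u - cd.EO j u) := by
      have := wn_toVec_le hω (mul_nonneg hlam hρE) hDu_ball
      rwa [hDudef, toVec_ofVec] at this
    -- (iii) the defect part
    set K := cd.RemV (cd.bb j) (cd.mC j u) (cd.h j u) +
      (1 / (1 - cd.bb j * (cd.mC j u + cd.ρO j u) * cd.h j u) ^ 2 - 1 / (1 - cd.bb j * cd.mC j u * cd.h j u) ^ 2)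
      with hKdef
    have hK : 0 ≤ K := stepDefect_nonneg hj hV hu
    set R := ofVec cd (D σ (cd.Tn j (u + 1))) - cd.Vap j u (cd.h j u) Du with hRdef
    have hR : cd.InBall j R (K * (lam * (cd.ρO j u - cd.EO j u))) :=
      inBall_mono hω (segDeriv_step hj hV hF hC hq hD hσ hu) (mul_le_mul_of_nonneg_left hwnDu hK)
    have hRw : cd.Wsupp R := fun i k hk => by
      simp only [hRdef, Pi.sub_apply, wsupp_ofVec cd _ i k hk, G3.wsupp_Vap hV hj hu.le _ _ i k hk, sub_zero]
    have hNCi1 := G3.NCi_clause hV hj hus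
    have hiii : |cd.Ci j (u + 1) R i k| ≤ cd.NCi j (u + 1) * cd.rP j (u + 1) i k * (K * (lam * (cd.ρO j u - cd.EO j u))) :=
      scale_ball_apply (G3.isLinearMap_Ci hV hj hus) (C := fun i k => cd.NCi j (u + 1) * cd.rP j (u + 1) i k)
        hNCi1.2 hRw (mul_nonneg hK (mul_nonneg hlam hρE)) hR i ⟨hk1, hk2⟩
    have hκB := κB_clause hV hj hu
    have hrP1 := G3.rP_nonneg hV hj hus i k
    have hiii' : |cd.Ci j (u + 1) R i k| ≤ cd.κB j u * lam * cd.rP j (u + 1) i k := by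
      calc |cd.Ci j (u + 1) R i k| ≤ cd.NCi j (u + 1) * cd.rP j (u + 1) i k * (K * (lam * (cd.ρO j u - cd.EO j u))) := hiii
        _ = (cd.NCi j (u + 1) * K * (cd.ρO j u - cd.EO j u)) * (lam * cd.rP j (u + 1) i k) := by ring
        _ ≤ cd.κB j u * (lam * cd.rP j (u + 1) i k) :=
            mul_le_mul_of_nonneg_right hκB (mul_nonneg hlam hrP1)
        _ = cd.κB j u * lam * cd.rP j (u + 1) i k := by ring
    -- (iv) assemble
    have hsplit : ofVec cd (D σ (cd.Tn j (u + 1))) = cd.Vap j u (cd.h j u) (cd.Cm j u ξ) + R := by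
      rw [hCmξ, hRdef]; abel
    have hCi_add := (G3.isLinearMap_Ci hV hj hus).map_add (cd.Vap j u (cd.h j u) (cd.Cm j u ξ)) R
    rw [hsplit, hCi_add, Pi.add_apply, Pi.add_apply, Finset.prod_range_succ]
    calc |cd.Ci j (u + 1) (cd.Vap j u (cd.h j u) (cd.Cm j u ξ)) i k + cd.Ci j (u + 1) R i k|
        ≤ |cd.Ci j (u + 1) (cd.Vap j u (cd.h j u) (cd.Cm j u ξ)) i k| + |cd.Ci j (u + 1) R i k| := abs_add_le _ _
      _ ≤ cd.rP j (u + 1) i k * lam + cd.κB j u * lam * cd.rP j (u + 1) i k := add_le_add hi hiii'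
      _ = lam * (1 + cd.κB j u) * cd.rP j (u + 1) i k := by ring
      _ = cd.NCi j 0 * cd.dm j * ((∏ u' ∈ Finset.range u, (1 + cd.κB j u')) * (1 + cd.κB j u)) *
            cd.rP j (u + 1) i k := by rw [hlamdef]; ring

/-- The ω-size of the derivative witness at node `u ≤ S − 1`. [folklore] -/
theorem wn_segDeriv_node (hj : j ≤ cd.N₀) (hV : cd.Valid) (hF : IsFlowPackage cd φ) (hC : ChainEnclosure cd φ)
    (hq : InPoly cd j q)
    (hD : ∀ σ ∈ Icc (0:ℝ) 1, ∀ t ∈ Icc 0 (cd.Tn j (cd.S j)),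
      HasDerivWithinAt (fun σ' => toVec cd (stAt φ j (seg cd j q σ') t)) (D σ t) (Icc 0 1) σ)
    (hσ : σ ∈ Icc (0:ℝ) 1) {u : ℕ} (hu : u ≤ cd.S j - 1) :
    0 ≤ cd.NCi j 0 * cd.dm j * ∏ u' ∈ Finset.range u, (1 + cd.κB j u') ∧
    wn cd j (D σ (cd.Tn j u)) ≤
      (cd.NCi j 0 * cd.dm j * ∏ u' ∈ Finset.range u, (1 + cd.κB j u')) * (cd.ρO j u - cd.EO j u) := by
  have hω := G3.omega_pos hV hj
  have huS : u ≤ cd.S j := hu.trans (Nat.sub_le _ _)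
  set lam : ℝ := cd.NCi j 0 * cd.dm j * ∏ u' ∈ Finset.range u, (1 + cd.κB j u') with hlamdef
  have hinv := frame_invariant hj hV hF hC hq hD hσ u hu
  have hlam : 0 ≤ lam := by
    have h1 := hinv cd.i₀ 1 (one_mem_window hV).1 (one_mem_window hV).2
    have hr := G3.rP_nonneg hV hj huS cd.i₀ 1
    rcases hr.eq_or_lt with h0 | hpos
    · refine mul_nonneg (mul_nonneg (G3.NCi_clause hV hj (Nat.zero_le _)).1 (dm_nonneg hV hj))
        (Finset.prod_nonneg fun u' hu' => ?_)
      have hu'S : u' < cd.S j := lt_of_lt_of_le (Finset.mem_range.1 hu') huS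
      have hκB := κB_clause hV hj hu'S
      have h2 : 0 ≤ cd.NCi j (u' + 1) * (cd.RemV (cd.bb j) (cd.mC j u') (cd.h j u') +
          (1 / (1 - cd.bb j * (cd.mC j u' + cd.ρO j u') * cd.h j u') ^ 2 -
            1 / (1 - cd.bb j * cd.mC j u' * cd.h j u') ^ 2)) * (cd.ρO j u' - cd.EO j u') :=
        mul_nonneg (mul_nonneg (G3.NCi_clause hV hj (by omega)).1 (stepDefect_nonneg hj hV hu'S))
          (sub_nonneg.2 (EO_le_ρO hV hj hu'S.le))
      linarith
    · exact nonneg_of_mul_nonneg_left ((abs_nonneg _).trans h1) hpos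
  refine ⟨hlam, ?_⟩
  set Du := ofVec cd (D σ (cd.Tn j u)) with hDudef
  have hfr := G3.frame_wsupp hV hj huS
  have hξw : cd.Wsupp (cd.Ci j u Du) := (hfr Du).2.1
  have hCmξ : cd.Cm j u (cd.Ci j u Du) = Du := ((hfr Du).2.2 (wsupp_ofVec cd _)).2
  have hDu_ball : cd.InBall j Du (lam * (cd.ρO j u - cd.EO j u)) := by
    intro i' k' hk1' hk2'
    have h := scale_par_apply (G3.isLinearMap_Cm hV hj huS) (C := fun i k => (cd.ρO j u - cd.EO j u) * cd.ω j k)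
      (fun ξ' hξ' i k hk1 hk2 => (G3.para_inBall hV hj huS ξ' hξ').2 i k hk1 hk2) hξw hlam
      (fun i k hk1 hk2 => hinv i k hk1 hk2) i' ⟨hk1', hk2'⟩
    rw [hCmξ] at h
    calc |Du i' k'| ≤ (cd.ρO j u - cd.EO j u) * cd.ω j k' * lam := h
      _ = lam * (cd.ρO j u - cd.EO j u) * cd.ω j k' := by ring
  have := wn_toVec_le hω (mul_nonneg hlam (sub_nonneg.2 (EO_le_ρO hV hj huS))) hDu_ball
  rwa [hDudef, toVec_ofVec] at this

/-- **Transport bound** on the last sub-step: at every time `t ∈ [Tn (S−1), Tn S]`,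
`wn (D σ t) ≤ L1 (S−1) · (NCi 0 · dm · ∏_{u<S−1} (1 + κB u)) · (ρO (S−1) − EO (S−1))`. [folklore] -/
theorem transport_bound (hj : j ≤ cd.N₀) (hV : cd.Valid) (hF : IsFlowPackage cd φ) (hC : ChainEnclosure cd φ)
    (hq : InPoly cd j q)
    (hD : ∀ σ ∈ Icc (0:ℝ) 1, ∀ t ∈ Icc 0 (cd.Tn j (cd.S j)),
      HasDerivWithinAt (fun σ' => toVec cd (stAt φ j (seg cd j q σ') t)) (D σ t) (Icc 0 1) σ)
    (hσ : σ ∈ Icc (0:ℝ) 1) {t : ℝ} (ht0 : cd.Tn j (cd.S j - 1) ≤ t) (ht1 : t ≤ cd.Tn j (cd.S j)) :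
    wn cd j (D σ t) ≤ cd.L1 j (cd.S j - 1) *
      ((cd.NCi j 0 * cd.dm j * ∏ u' ∈ Finset.range (cd.S j - 1), (1 + cd.κB j u')) *
        (cd.ρO j (cd.S j - 1) - cd.EO j (cd.S j - 1))) := by
  have hω := G3.omega_pos hV hj
  set s := cd.S j - 1 with hsdef
  have hs : s < cd.S j := S_sub_one_lt hV hj
  have hS : s + 1 = cd.S j := Nat.sub_add_cancel (G3.one_le_S hV hj)
  set T := cd.Tn j (cd.S j) with hTdef
  set T₀ := cd.Tn j s with hT₀def
  set hh := cd.h j s with hhdef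
  have hT₀ : 0 ≤ T₀ := G3.Tn_nonneg hV hj hs.le
  have hTS : T = T₀ + hh := by rw [hTdef, ← hS]; exact G3.Tn_succ hV hj hs
  have hh0 : 0 < hh := G3.h_pos hV hj hs
  set t' := t - T₀ with ht'def
  have ht' : t' ∈ Icc 0 hh := ⟨by linarith, by linarith⟩
  -- flow property at the last node
  have hsol : ∀ σ' ∈ Icc (0:ℝ) 1, SolvesOn cd φ j (seg cd j q σ') T := fun σ' hσ' =>
    (hC j hj _ (inPoly_seg (inPoly_x0 hV hj) hq hσ')).1
  have hshift : ∀ σ' ∈ Icc (0:ℝ) 1, stAt φ j (seg cd j q σ') t =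
      stAt φ j (stAt φ j (seg cd j q σ') T₀) t' := by
    intro σ' hσ'
    have e : t = T₀ + t' := by rw [ht'def]; ring
    rw [e]
    exact G3.stAt_shift hF hj (hsol σ' hσ') hT₀ ⟨ht'.1, by linarith [ht'.2]⟩
  -- increments on the last leg, by the (F4) two-point Lipschitz estimate at centre x (S-1)
  have hA := hD σ hσ t ⟨hT₀.trans ht0, ht1⟩
  have hB := hD σ hσ T₀ ⟨hT₀, by linarith⟩
  set C : ℝ := 1 / (1 - cd.bb j * (cd.mC j s + cd.ρO j s) * t') ^ 2 with hCdef
  have hρO : 0 ≤ cd.ρO j s :=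
    (EI_nonneg hV hj hs.le).trans (((EI_le_E hV hj hs.le).trans (E_le_EO hV hj hs.le)).trans (EO_le_ρO hV hj hs.le))
  have hincr : ∀ᶠ σ' in 𝓝[Icc (0:ℝ) 1] σ, ∀ c,
      |(toVec cd (stAt φ j (seg cd j q σ') t) - toVec cd (stAt φ j (seg cd j q σ) t) -
        (0 : (Fin (nW cd) → ℝ) →L[ℝ] (Fin (nW cd) → ℝ))
          (toVec cd (stAt φ j (seg cd j q σ') T₀) - toVec cd (stAt φ j (seg cd j q σ) T₀))) c| ≤
        (C * wW cd j c) * wn cd j (toVec cd (stAt φ j (seg cd j q σ') T₀) - toVec cd (stAt φ j (seg cd j q σ) T₀)) := by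
    filter_upwards [self_mem_nhdsWithin] with σ' hσ'
    intro c
    set y := stAt φ j (seg cd j q σ') T₀ with hydef
    set y' := stAt φ j (seg cd j q σ) T₀ with hy'def
    have hy : cd.InBall j (y - cd.x j s) (cd.ρO j s) := node_inBall_ρO hV hj hC (inPoly_seg (inPoly_x0 hV hj) hq hσ') hs.le
    have hy' : cd.InBall j (y' - cd.x j s) (cd.ρO j s) := node_inBall_ρO hV hj hC (inPoly_seg (inPoly_x0 hV hj) hq hσ) hs.le
    have hdd : cd.InBall j (y - y') (wn cd j (toVec cd (y - y'))) := inBall_wn_toVec hω _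
    have h4 := G3.inBall_sub_of_F4 hF hj (mC_nonneg hV hj hs.le) hρO (inBall_x hV hj hs.le) hh0.le
      (guard_ρO hV hj hs) hy hy' hdd ht'
    rw [← hshift σ' hσ', ← hshift σ hσ] at h4
    have h4c := (inBall_iff_toVec cd j _ _).1 h4 c
    rw [zero_apply, sub_zero, ← toVec_sub, ← toVec_sub]
    calc |toVec cd (stAt φ j (seg cd j q σ') t - stAt φ j (seg cd j q σ) t) c|
        ≤ C * wn cd j (toVec cd (y - y')) * wW cd j c := h4c
      _ = C * wW cd j c * wn cd j (toVec cd (y - y')) := by ring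
  have hlim := deriv_bound_of_increment_bound hσ hA hB 0 (continuous_wn j) (wn_smul j) (fun c => C * wW cd j c) hincr
  simp only [zero_apply, sub_zero] at hlim
  -- the ω-size at time t
  have hC0 : 0 ≤ C := one_div_sq_nonneg _
  have hwt : wn cd j (D σ t) ≤ C * wn cd j (D σ T₀) :=
    wn_le hω _ (mul_nonneg hC0 (wn_nonneg j _)) fun c => by
      calc |D σ t c| ≤ C * wW cd j c * wn cd j (D σ T₀) := hlim c
        _ = C * wn cd j (D σ T₀) * wW cd j c := by ring
  -- C ≤ L1 (exit clause) and the node bound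
  have hbb := G3.bb_nonneg hV hj
  have ha : 0 ≤ cd.bb j * (cd.mC j s + cd.ρO j s) := mul_nonneg hbb (add_nonneg (mC_nonneg hV hj hs.le) hρO)
  have hCL : C ≤ cd.L1 j s := by
    have h1 : C ≤ 1 / (1 - cd.bb j * (cd.mC j s + cd.ρO j s) * hh) ^ 2 := by
      have := one_div_sq_mono ha ht'.1 ht'.2 (by have := guard_ρO hV hj hs; rwa [hhdef])
      simpa [hCdef, mul_assoc] using this
    exact h1.trans (L1_exit hV hj s hs)
  obtain ⟨hlam, hnode⟩ := wn_segDeriv_node hj hV hF hC hq hD hσ (le_refl s)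
  have hρE : 0 ≤ cd.ρO j s - cd.EO j s := sub_nonneg.2 (EO_le_ρO hV hj hs.le)
  calc wn cd j (D σ t) ≤ C * wn cd j (D σ T₀) := hwt
    _ ≤ cd.L1 j s * wn cd j (D σ T₀) := mul_le_mul_of_nonneg_right hCL (wn_nonneg j _)
    _ ≤ cd.L1 j s * ((cd.NCi j 0 * cd.dm j * ∏ u' ∈ Finset.range s, (1 + cd.κB j u')) * (cd.ρO j s - cd.EO j s)) :=
        mul_le_mul_of_nonneg_left hnode (hC0.trans hCL)

end Deriv

end Summit.NavierStokesRegularity.NavierStokesRegularity.Theorems.TaylorModelReadout.G4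

end
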